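import Literature.MathematicalPhysics.QuantumFieldTheory.Balaban1983to89.B6Lemma24TwoScaleBookkeeping

/-!
# `Balaban1983to89.B6Lemma24TwoScale` — T. Bałaban, *Propagators and renormalization transformations for lattice gauge theories. II*, Commun. Math. Phys.
# **96** (1984) 223–250 [Balaban1984PropagatorsII], Lemma 2.4 (2.128) p. 245 for the TWO-LEVEL CUBE (2.89) p. 239: **THE TWO-SCALE LEMMA-2.4 LETTER ON b06's ℤᵈ CARRIER**

statement-level skeleton of published theorems with citation tags; proofs where landed; nothing here is a claim about the Yang–Mills mass gap

PDF held: `paper:balaban1984-cmp96-propagators-rt-ii` (journal page = PDF page + 222), pp. 239, 244–245.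

CITATION HEADER (lean-in-tree rule).  Cell `pub-ymgap` (Track A, HUMAN RULING D-0062), node N10 [B13] lane owner `pub-ymgap-dag-n10-c` (g18), ROAD «C» station C6b
(design `HOME/pub-ymgap-dag-n10-c/C6-DESIGN.md`; bus INBOX 2026-08-28T17:54Z INTENT-1), filed `--supports stmt-QuantumFields-27364` (count-neutral helper).  WHY: the
volume-free coercivity `m_□` of the local-cube road (N06 row 17 on (3.35)) for a cube MEETING `Ω_{j+1}` needs the Lemma-2.4 letter of C1 (`B6SectADeltaACoerciveReductionV1.
deltaAE_coercive_of_treeGauge_letters`) with `Q`-terms over INDICES only — at two scales, the interface read through `Q_{j+1}` (print's (2.89)).  This file proves that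
letter in b06's ℤᵈ currency; the transport to r03's V1 carriers (pattern `B6SectALemma24OneLevelV1`) is station C6c.  IMPORTS `B6Lemma24TwoScaleBookkeeping` (this
lane: coverage, vanishing, absorptions; through it C6a `B6Lemma24TwoScaleComposite` and pv09's `B6Lemma24Printed` ∕ `B6Lemma24Assembly` ∕ `B6Lemma24Carrier`).

THE PRINT (verbatim, p. 245): *«L^{d−2} Σ_{c∈Λ′} |(Q₁B)(c)|² + Σ_p |(∂₁B)(p)|² ≥ (1∕(12d²)) L^{−d−1} ‖B‖². (2.128)»*; p. 239: *«We define B^j(Λ) = □̃ ∩ B^{j+1}(Λ_{j+1}),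
(2.89) and we take Q′*aQ′, Q*aQ equal to Q′*_{j+1}a_{j+1}Q′_{j+1}, Q*_{j+1}a_{j+1}Q_{j+1} on B^j(Λ), and to Q′*_ja_jQ′_j, Q*_ja_jQ_j on □̃ ∖ B^j(Λ)»*.

WHAT IS PROVED (sorry-free; standard axioms):
* `composite_coeff_le` [folklore]: `(N + 3)·N^{−d}·n^{d+1} ≤ 4n²` (`1 ≤ n ≤ N`, `d ≥ 1`).
* `assembly_core_two` [folklore]: the two-scale scalar assembly (pure real arithmetic, powers abstracted to letters): the small scale enters ASSEMBLED (pv09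
  `assembly_core_one` applied with `Nrm := Slay^S + N_in^S`), the big scale by hand so that the composite terms keep their `N^{−d}` — they cost the factor `4n²`, not
  `n^{d+1}`.
* ★★★ **`lemma24_twoScale`**: for `d ≥ 2`, `n, L ≥ 1`, `N = nL`, `Λs ⊂ nℤᵈ`, `Λb ⊂ Nℤᵈ` finite with disjoint regions, every `N`-neighbour of a big block admissible
  (big ∕ composite ∕ empty), `B = 0` off `bonds₂`, tree gauge (2.121) in every small and every big block:
  **`N^{−(d+1)}·‖B‖²_{bonds₂} ≤ 12d²·(1 + 12·d·n²)·( n^{d−2}·Σ_{c ∈ idxS} q1Term n B c + N^{d−2}·q1Of N Λb B + d1Sq n Λs B + d1Sq N Λb B )`** — Q-terms (pv09's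
  verbatim (2.125) transcription `q1Term`) ONLY over the small indices `idxS` (small faces between blocks not inside big blocks) and the big coarse bonds meeting `Λb`
  (the interface small∕big among them), plaquette sums over pv09's `lamPlaq` of each region (their overlap counted twice — harmless for a letter of the shape
  `κ‖B‖² ≤ ‖∂B‖² + …` after halving `κ`); `lemma24_twoScale_kappa`: the `κ₂`-form, `κ₂ = (12d²(1+12dn²))⁻¹·N^{−(d+1)}` explicit and VOLUME-FREE.
PROOF ROUTE (the cell's, as for pv09's one-scale Lemma): pv09 `face_split` at both scales with the layer constant `2∕(m+1)` (`layerIneq_two_over`, `m = n, N`), the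
two-scale coverage and absorptions of `B6Lemma24TwoScaleBookkeeping`, (2.123) at both scales (`B6TreeGaugePoincare.ineq2123_rescaled`), `assembly_core_one` for the
small scale, `assembly_core_two`.
HONEST SCOPE.  (i) The inequality is the cell's two-scale analogue of (2.128) for print's two-level cube (2.89); print states Lemma 2.4 at one scale and treats the
two-level cube through the construction (2.89)–(2.94); nothing printed is asserted or used as a hypothesis.  (ii) The constant degrades against pv09's `12d²` by
`(1 + 12dn²)` (`n` = the small block side): explicit and volume-free but, like the one-level letter of `B6SectALemma24OneLevelV1`, level-dependent; no `k`-uniformity is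
claimed.  (iii) ℤᵈ carrier with *«B = 0 outside»*: the torus∕V1 editions are NOT here (station C6c).  (iv) §3 (v1.1, append-only): ★★★ `lemma24_twoScale_noAdm` ∕
`lemma24_twoScale_kappa_noAdm` — the SAME inequality WITHOUT the admissibility hypothesis (the bookkeeping file's §6: positions outside `Λb` are generalised composites), so
cubes whose level-`j` part is not a union of `(j+1)`-positions are admitted.  NOT a node discharge; count-neutral; nothing continuum ∕ OS ∕ mass gap ∕ Clay.
-/

namespace Literature.MathematicalPhysics.QuantumFieldTheory.Balaban1983to89.B6Lemma24TwoScale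

open Finset
open B6Elimination (corner)
open B6BondElimination (unitVec treeBonds)
open B6TreeGaugePoincare (Cfg curl innerBonds innerPlaq ineq2123_rescaled)
open B6FaceInterpolation (lastLayer firstLayer bondsIn)
open B6Lemma24Carrier (nIn pIn d1Sq coarseBonds q1Term q1Of q1Of_nonneg pIn_le_d1Sq)
open B6Lemma24Assembly (faces_le_pCr)
open B6Lemma24Printed (sum_face_split layerIneq_two_over assembly_core_one coeff_cr_le coeff_layer_le)
open B6LayerPoincarePair (kappa1 kappa1_pos)
open B6LayerUpperBound (kappa1_two)
open B6Lemma24TwoScaleBookkeeping (bonds₂ normSq₂ idxS crossS crossB compG Adm crossS_nonneg crossing_cover₂ sum_face_split_idxS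
  sum_blockSq_idxS_minus_le sum_blockSq_idxS_plus_le sum_layerLast_idxS_le sum_layerFirst_idxS_le faces_idxS_le
  sum_innerMinus_big_le sum_innerPlus_big_le sum_layerLast_big_le sum_layerFirst_big_le)

noncomputable section

variable {d : ℕ} {n L : ℕ}

/-! ## §1. The two-scale scalar assembly -/

/-- the geometric factor of the composite terms: `(N + 3)·N^{−d}·n^{d+1} ≤ 4n²` for `1 ≤ n ≤ N`, `d ≥ 1`. [cite: Balaban1984PropagatorsII, (2.89) p.239, (2.128) p.245; folklore] -/
theorem composite_coeff_le {d : ℕ} (hd : 1 ≤ d) {n N : ℝ} (hn : 1 ≤ n) (hnN : n ≤ N) :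
    (N + 3) * (N⁻¹) ^ d * n ^ (d + 1) ≤ 4 * n ^ 2 := by
  have hN0 : 0 < N := by linarith
  have hX0 : 0 ≤ N⁻¹ := by positivity
  have hXN : N⁻¹ * N = 1 := inv_mul_cancel₀ hN0.ne'
  have hXn0 : 0 ≤ N⁻¹ * n := by positivity
  have hXn1 : N⁻¹ * n ≤ 1 := by
    calc N⁻¹ * n ≤ N⁻¹ * N := mul_le_mul_of_nonneg_left hnN hX0
      _ = 1 := hXN
  have e : (N⁻¹) ^ d * n ^ (d + 1) = (N⁻¹ * n) ^ d * n := by rw [mul_pow, pow_succ]; ring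
  have h1 : (N⁻¹ * n) ^ d ≤ N⁻¹ * n := by
    calc (N⁻¹ * n) ^ d ≤ (N⁻¹ * n) ^ 1 := pow_le_pow_of_le_one hXn0 hXn1 hd
      _ = N⁻¹ * n := pow_one _
  have h2 : (N⁻¹ * n) ^ d ≤ 1 := pow_le_one₀ hXn0 hXn1
  have hn0 : (0 : ℝ) ≤ n := by linarith
  have h3 : N * ((N⁻¹ * n) ^ d * n) ≤ N * ((N⁻¹ * n) * n) :=
    mul_le_mul_of_nonneg_left (mul_le_mul_of_nonneg_right h1 hn0) hN0.le
  have h4 : 3 * ((N⁻¹ * n) ^ d * n) ≤ 3 * (1 * n) := by nlinarith [h2, hn0]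
  calc (N + 3) * (N⁻¹) ^ d * n ^ (d + 1) = N * ((N⁻¹ * n) ^ d * n) + 3 * ((N⁻¹ * n) ^ d * n) := by rw [mul_assoc, e]; ring
    _ ≤ N * ((N⁻¹ * n) * n) + 3 * (1 * n) := add_le_add h3 h4
    _ = n ^ 2 * (N⁻¹ * N) + 3 * n := by ring
    _ = n ^ 2 + 3 * n := by rw [hXN, mul_one]
    _ ≤ 4 * n ^ 2 := by nlinarith [hn]

/-- **The two-scale scalar assembly** (pure real-number bookkeeping, every power abstracted to a real letter: `p = N^{−d}`, `p₁ = N^{−d−1}`, `q₁ = n^{−d−1}`,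
`m = n^{d+1}`, `r = n^{d−2}`, `R = N^{d−2}`, `τ = (d−1)(N−1)N^{d−2}`).  Inputs: the two-scale coverage `‖B‖² − N_in^S − N_in^B ≤ Slay^S + Slay^B`; the small scale
already assembled by pv09's `assembly_core_one` in the form `q₁(Slay^S + N_in^S) ≤ 12d²·A^S`, `A^S = rQ^S + P_in^S + P_cr^S`; the big-face split at scale `N = nL`
with `3/κ = 3(N+1)/2`; the big absorptions `N′ + N″ ≤ 2d·N_in^B + 2d·W`, `F ≤ P_cr^B`, `T′ + T″ ≤ 2τ·d·P_in^B + 2d·W` with the composite weight `W = Slay^S + N_in^S`;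
the summed (2.123) at scale `N` (`p·N_in^B ≤ d·P_in^B`); the coefficient facts `3(N+1)p/2 ≤ 3` (pv09 `coeff_cr_le`), `3(N+1)pτ/2 ≤ 3(d−1)/2` (pv09 `coeff_layer_le`),
`(N+3)·p·m ≤ 4n²` (`composite_coeff_le`).  Output: `p₁‖B‖² ≤ 12d²(1 + 12·d·n²)·(A^S + A^B)`, `A^B = RQ^B + P_in^B + P_cr^B` — the composite terms keep their `p`
and cost the factor `4n²` only. [cite: Balaban1984PropagatorsII, (2.123)–(2.128) pp.244–245, (2.89) p.239; folklore] -/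
theorem assembly_core_two
    (dR nR NR p p₁ q₁ m r R τ Nrm NinS NinB PinS PinB PcrS PcrB QS QB SlayS SlayB NB1 NB2 FB TB1 TB2 : ℝ)
    (hd : 2 ≤ dR) (hp : 0 ≤ p) (hp₁ : 0 ≤ p₁) (hp₁p : p₁ ≤ p) (hp₁q : p₁ ≤ q₁) (hqm : q₁ * m = 1) (hm : 0 ≤ m) (hr : 0 ≤ r) (hR : 1 ≤ R)
    (hcr : 3 * (NR + 1) / 2 * p ≤ 3) (hτ : 3 * (NR + 1) / 2 * p * τ ≤ 3 / 2 * (dR - 1)) (hcN0 : 0 ≤ 3 * (NR + 1) / 2 * p)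
    (hgeom : (NR + 3) * p * m ≤ 4 * nR ^ 2)
    (hNinS : 0 ≤ NinS) (hNinB : 0 ≤ NinB) (hPinS : 0 ≤ PinS) (hPinB : 0 ≤ PinB) (hPcrS : 0 ≤ PcrS) (hPcrB : 0 ≤ PcrB)
    (hQS : 0 ≤ QS) (hQB : 0 ≤ QB) (hSlayS : 0 ≤ SlayS)
    (hC : Nrm - NinS - NinB ≤ SlayS + SlayB)
    (hW : q₁ * (SlayS + NinS) ≤ 12 * dR ^ 2 * (r * QS + PinS + PcrS))
    (hSB : p₁ * SlayB ≤ 3 * QB + 3 * p * (NB1 + NB2) + 3 * (NR + 1) / 2 * p * (FB + TB1 + TB2))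
    (hNB : NB1 + NB2 ≤ 2 * dR * NinB + 2 * dR * (NinS + SlayS)) (hFB : FB ≤ PcrB)
    (hTB : TB1 + TB2 ≤ 2 * (τ * (dR * PinB)) + 2 * dR * (NinS + SlayS)) (hIIB : p * NinB ≤ dR * PinB) :
    p₁ * Nrm ≤ 12 * dR ^ 2 * (1 + 12 * dR * nR ^ 2) * ((r * QS + PinS + PcrS) + (R * QB + PinB + PcrB)) := by
  have hd0 : 0 < dR := by linarith
  have hW0 : 0 ≤ SlayS + NinS := add_nonneg hSlayS hNinS
  have hAS0 : 0 ≤ r * QS + PinS + PcrS := by have h := mul_nonneg hr hQS; linarith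
  -- coverage, weighted by `p₁`
  have a0 : p₁ * Nrm ≤ p₁ * (SlayS + NinS) + p₁ * NinB + p₁ * SlayB := by
    have h := mul_le_mul_of_nonneg_left hC hp₁
    linarith
  -- the small scale with the weaker big weight
  have a1 : p₁ * (SlayS + NinS) ≤ 12 * dR ^ 2 * (r * QS + PinS + PcrS) := (mul_le_mul_of_nonneg_right hp₁q hW0).trans hW
  -- the big inner blocks
  have a2 : p₁ * NinB ≤ dR * PinB := (mul_le_mul_of_nonneg_right hp₁p hNinB).trans hIIB
  -- the big faces with the absorptions substituted
  have hFT : FB + TB1 + TB2 ≤ PcrB + 2 * (τ * (dR * PinB)) + 2 * dR * (SlayS + NinS) := by linarith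
  have hNB' : NB1 + NB2 ≤ 2 * dR * NinB + 2 * dR * (SlayS + NinS) := by linarith
  have a3 : p₁ * SlayB ≤ 3 * QB + 3 * p * (2 * dR * NinB + 2 * dR * (SlayS + NinS)) +
      3 * (NR + 1) / 2 * p * (PcrB + 2 * (τ * (dR * PinB)) + 2 * dR * (SlayS + NinS)) := by
    have h1 := mul_le_mul_of_nonneg_left hNB' (by positivity : (0 : ℝ) ≤ 3 * p)
    have h2 := mul_le_mul_of_nonneg_left hFT hcN0
    linarith [hSB, h1, h2]
  have b1 : 3 * p * (2 * dR * NinB) ≤ 6 * dR ^ 2 * PinB := by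
    have hd0 : (0 : ℝ) ≤ 6 * dR := by linarith
    have h := mul_le_mul_of_nonneg_left hIIB hd0
    have e1 : 3 * p * (2 * dR * NinB) = 6 * dR * (p * NinB) := by ring
    have e2 : 6 * dR * (dR * PinB) = 6 * dR ^ 2 * PinB := by ring
    rw [e1, ← e2]; exact h
  have b2 : 3 * (NR + 1) / 2 * p * PcrB ≤ 3 * PcrB := mul_le_mul_of_nonneg_right hcr hPcrB
  have b3 : 3 * (NR + 1) / 2 * p * (2 * (τ * (dR * PinB))) ≤ 3 * (dR - 1) * (dR * PinB) := by
    have hdP : 0 ≤ dR * PinB := mul_nonneg (by linarith) hPinB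
    have h := mul_le_mul_of_nonneg_right hτ hdP
    have e1 : 3 * (NR + 1) / 2 * p * (2 * (τ * (dR * PinB))) = 2 * (3 * (NR + 1) / 2 * p * τ * (dR * PinB)) := by ring
    rw [e1]
    linarith
  -- the composite weight: `(6d + 3d(N+1))·p·W = 3d(N+3)·p·W ≤ 3d · 4n² · 12d²A^S`
  have b4 : (3 * p * (2 * dR) + 3 * (NR + 1) / 2 * p * (2 * dR)) * (SlayS + NinS) ≤
      144 * dR ^ 3 * nR ^ 2 * (r * QS + PinS + PcrS) := by
    have hWle : SlayS + NinS ≤ m * (12 * dR ^ 2 * (r * QS + PinS + PcrS)) := by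
      have h := mul_le_mul_of_nonneg_left hW hm
      calc SlayS + NinS = m * (q₁ * (SlayS + NinS)) := by rw [← mul_assoc, mul_comm m, hqm, one_mul]
        _ ≤ _ := h
    have hcoef : 3 * p * (2 * dR) + 3 * (NR + 1) / 2 * p * (2 * dR) = 3 * dR * ((NR + 3) * p) := by ring
    have hNp : 0 ≤ (NR + 3) * p := by linarith [hcN0, hp]
    rw [hcoef]
    calc 3 * dR * ((NR + 3) * p) * (SlayS + NinS) ≤ 3 * dR * ((NR + 3) * p) * (m * (12 * dR ^ 2 * (r * QS + PinS + PcrS))) :=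
          mul_le_mul_of_nonneg_left hWle (by positivity)
      _ = 3 * dR * (12 * dR ^ 2 * (r * QS + PinS + PcrS)) * ((NR + 3) * p * m) := by ring
      _ ≤ 3 * dR * (12 * dR ^ 2 * (r * QS + PinS + PcrS)) * (4 * nR ^ 2) := mul_le_mul_of_nonneg_left hgeom (by positivity)
      _ = 144 * dR ^ 3 * nR ^ 2 * (r * QS + PinS + PcrS) := by ring
  -- total
  have expand : 3 * p * (2 * dR * NinB + 2 * dR * (SlayS + NinS)) +
      3 * (NR + 1) / 2 * p * (PcrB + 2 * (τ * (dR * PinB)) + 2 * dR * (SlayS + NinS)) =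
      3 * p * (2 * dR * NinB) + 3 * (NR + 1) / 2 * p * PcrB + 3 * (NR + 1) / 2 * p * (2 * (τ * (dR * PinB))) +
        (3 * p * (2 * dR) + 3 * (NR + 1) / 2 * p * (2 * dR)) * (SlayS + NinS) := by ring
  have htot : p₁ * Nrm ≤ 12 * dR ^ 2 * (r * QS + PinS + PcrS) + dR * PinB + 3 * QB + 6 * dR ^ 2 * PinB + 3 * PcrB +
      3 * (dR - 1) * (dR * PinB) + 144 * dR ^ 3 * nR ^ 2 * (r * QS + PinS + PcrS) := by
    linarith [a0, a1, a2, a3, b1, b2, b3, b4, expand]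
  -- the final comparison of coefficients, `K = 12d²(1 + 12dn²) = 12d² + 144d³n² ≥ 48`
  have hK : 12 * dR ^ 2 * (1 + 12 * dR * nR ^ 2) = 12 * dR ^ 2 + 144 * dR ^ 3 * nR ^ 2 := by ring
  have hd2 : (4 : ℝ) ≤ dR ^ 2 := by
    rw [pow_two]; exact le_trans (by norm_num : (4 : ℝ) ≤ 2 * 2) (mul_le_mul hd hd (by norm_num) (by linarith))
  have hdn : (0 : ℝ) ≤ 144 * dR ^ 3 * nR ^ 2 := mul_nonneg (mul_nonneg (by norm_num) (pow_nonneg (by linarith) 3)) (sq_nonneg _)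
  have hK48 : (48 : ℝ) ≤ 12 * dR ^ 2 * (1 + 12 * dR * nR ^ 2) := by rw [hK]; linarith
  have hK0 : (0 : ℝ) ≤ 12 * dR ^ 2 * (1 + 12 * dR * nR ^ 2) := by linarith
  have c1 : 3 * QB ≤ 12 * dR ^ 2 * (1 + 12 * dR * nR ^ 2) * (R * QB) := by
    have h1 : QB ≤ R * QB := le_mul_of_one_le_left hQB hR
    have h2 := mul_le_mul_of_nonneg_left h1 hK0
    have h3 : 3 * QB ≤ 12 * dR ^ 2 * (1 + 12 * dR * nR ^ 2) * QB := mul_le_mul_of_nonneg_right (by linarith) hQB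
    linarith
  have c2 : dR * PinB + 6 * dR ^ 2 * PinB + 3 * (dR - 1) * (dR * PinB) ≤ 12 * dR ^ 2 * (1 + 12 * dR * nR ^ 2) * PinB := by
    have e : dR * PinB + 6 * dR ^ 2 * PinB + 3 * (dR - 1) * (dR * PinB) = (9 * dR ^ 2 - 2 * dR) * PinB := by ring
    rw [e]
    refine mul_le_mul_of_nonneg_right ?_ hPinB
    rw [hK]
    linarith [hd2, hdn]
  have c3 : 3 * PcrB ≤ 12 * dR ^ 2 * (1 + 12 * dR * nR ^ 2) * PcrB := mul_le_mul_of_nonneg_right (by linarith) hPcrB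
  have e : 12 * dR ^ 2 * (1 + 12 * dR * nR ^ 2) * ((r * QS + PinS + PcrS) + (R * QB + PinB + PcrB)) =
      (12 * dR ^ 2 * (r * QS + PinS + PcrS) + 144 * dR ^ 3 * nR ^ 2 * (r * QS + PinS + PcrS)) +
        12 * dR ^ 2 * (1 + 12 * dR * nR ^ 2) * (R * QB) + 12 * dR ^ 2 * (1 + 12 * dR * nR ^ 2) * PinB +
        12 * dR ^ 2 * (1 + 12 * dR * nR ^ 2) * PcrB := by ring
  rw [e]
  linarith [htot, c1, c2, c3]

/-! ## §2. ★★★ The two-scale Lemma-2.4 letter -/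

/-- ★★★ **THE TWO-SCALE LEMMA-2.4 LETTER** (print's two-level cube (2.89) in b06's ℤᵈ currency).  Let `d ≥ 2`, `n, L ≥ 1`, `N = nL`; `Λs ⊂ nℤᵈ` (small corners),
`Λb ⊂ Nℤᵈ` (big corners) finite, the regions disjoint (`corner_N y ∉ Λb` for `y ∈ Λs`), and every `N`-neighbour `Y ± N e_μ` of a big block `Y ∈ Λb` ADMISSIBLE
(`Adm`: a big block, or COMPOSITE — all its `n`-sub-corners in `Λs` —, or EMPTY — none of them; at a two-level cube this is the separation (2.2)).  Let `B` vanish off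
the bonds of the two regions (`bonds₂`) and satisfy the tree gauge (2.121) in every small block (scale `n`) and every big block (scale `N`).  Then
`N^{−(d+1)}·‖B‖² ≤ 12d²·(1 + 12·d·n²)·( n^{d−2}·Σ_{c ∈ idxS}|(Q₁B)(c)|² + N^{d−2}·Σ_{C meeting Λb}|(Q₁^{(N)}B)(C)|² + Σ_{p near Λ^S}|∂₁B|² + Σ_{p near Λ^B}|∂₁B|² )`,
the `Q`-terms running ONLY over indices: the small coarse bonds between blocks not inside big blocks (`idxS`) and all big coarse bonds meeting `Λb` (the interface
small∕big is read through `Q^{(N)}` of the big bonds `⟨Y₀, Y⟩`, `Y₀` composite).  Proof: pv09's per-face split at both scales (`B6Lemma24Printed.face_split`, layer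
constant `2/(m+1)` at `m = n, N`), the small scale assembled by `assembly_core_one`, the big absorptions of `B6Lemma24TwoScaleBookkeeping`, (2.123) at both scales,
`assembly_core_two`. [cite: Balaban1984PropagatorsII, Lemma 2.4 (2.128) p.245, (2.89) p.239] -/
theorem lemma24_twoScale (hd : 2 ≤ d) (hn : 1 ≤ n) (hL : 1 ≤ L) {Λs Λb : Finset (Fin d → ℤ)}
    (hΛs : ∀ y ∈ Λs, ∀ i, (n : ℤ) ∣ y i) (hΛb : ∀ Y ∈ Λb, ∀ i, ((n * L : ℕ) : ℤ) ∣ Y i)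
    (hdisj : ∀ y ∈ Λs, corner (n * L) y ∉ Λb)
    (hH : ∀ Y ∈ Λb, ∀ μ : Fin d, Adm n L Λs Λb (Y + ((n * L : ℕ) : ℤ) • unitVec μ) ∧ Adm n L Λs Λb (Y - ((n * L : ℕ) : ℤ) • unitVec μ))
    (B : Cfg d) (hB0 : ∀ b, b ∉ bonds₂ n L Λs Λb → B b = 0)
    (hTs : ∀ y ∈ Λs, ∀ b ∈ treeBonds n y, B b = 0) (hTb : ∀ Y ∈ Λb, ∀ b ∈ treeBonds (n * L) Y, B b = 0) :
    (((n * L : ℕ) : ℝ)⁻¹) ^ (d + 1) * normSq₂ n L Λs Λb B ≤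
      12 * (d : ℝ) ^ 2 * (1 + 12 * (d : ℝ) * (n : ℝ) ^ 2) *
        ((n : ℝ) ^ (d - 2) * ∑ c ∈ idxS n L Λs Λb, q1Term n B c + ((n * L : ℕ) : ℝ) ^ (d - 2) * q1Of (n * L) Λb B +
          d1Sq n Λs B + d1Sq (n * L) Λb B) := by
  have hN : 1 ≤ n * L := Nat.mul_pos hn hL
  have hd1 : 1 ≤ d := le_trans (by norm_num) hd
  -- the small scale: pv09's assembly with `Nrm := crossS + N_in^S`
  have hκn : 0 < kappa1 2 n := kappa1_pos (by norm_num) hn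
  have hSS := sum_face_split_idxS (L := L) hd hn hκn (layerIneq_two_over hd hn) Λs Λb B
  have hkn : 3 / kappa1 2 n = 3 * ((n : ℝ) + 1) / 2 := by rw [kappa1_two]; field_simp
  rw [hkn] at hSS
  have hNS1 := sum_blockSq_idxS_minus_le hn hL hΛs hΛb hB0
  have hNS2 := sum_blockSq_idxS_plus_le hn hL hΛs hΛb hB0
  have hFS := faces_idxS_le (L := L) hn hΛs Λb B
  have hTS1 := sum_layerLast_idxS_le hd1 hn hL hΛs hΛb hB0 hTs
  have hTS2 := sum_layerFirst_idxS_le hd1 hn hL hΛs hΛb hB0 hTs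
  have hIIS : ((n : ℝ)⁻¹) ^ d * nIn n Λs B ≤ (d : ℝ) * pIn n Λs B := ineq2123_rescaled hn Λs B hTs
  have hNinS0 : 0 ≤ nIn n Λs B := sum_nonneg fun _ _ => sum_nonneg fun _ _ => sq_nonneg _
  have hNinB0 : 0 ≤ nIn (n * L) Λb B := sum_nonneg fun _ _ => sum_nonneg fun _ _ => sq_nonneg _
  have hPinS0 : 0 ≤ pIn n Λs B := sum_nonneg fun _ _ => sum_nonneg fun _ _ => sq_nonneg _
  have hPinB0 : 0 ≤ pIn (n * L) Λb B := sum_nonneg fun _ _ => sum_nonneg fun _ _ => sq_nonneg _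
  have hFS0 : (0 : ℝ) ≤ ∑ c ∈ idxS n L Λs Λb, ∑ b ∈ bondsIn (lastLayer n c.1 c.2), curl B b.1 b.2 c.2 ^ 2 :=
    sum_nonneg fun _ _ => sum_nonneg fun _ _ => sq_nonneg _
  have hFB0 : (0 : ℝ) ≤ ∑ C ∈ coarseBonds (n * L) Λb, ∑ b ∈ bondsIn (lastLayer (n * L) C.1 C.2), curl B b.1 b.2 C.2 ^ 2 :=
    sum_nonneg fun _ _ => sum_nonneg fun _ _ => sq_nonneg _
  have hQS0 : (0 : ℝ) ≤ ∑ c ∈ idxS n L Λs Λb, q1Term n B c := sum_nonneg fun _ _ => sq_nonneg _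
  have hW := assembly_core_one d n hd hn (crossS n L Λs Λb B + nIn n Λs B) (nIn n Λs B) (pIn n Λs B) (d1Sq n Λs B - pIn n Λs B)
    (∑ c ∈ idxS n L Λs Λb, q1Term n B c) (crossS n L Λs Λb B) _ _ _ _ _ hNinS0 hPinS0 (hFS0.trans hFS) hQS0
    (by linarith) hSS hNS1 hNS2 hFS hTS1 hTS2 hIIS
  -- the big scale
  have hκN : 0 < kappa1 2 (n * L) := kappa1_pos (by norm_num) hN
  have hSB := sum_face_split hd hN hκN (layerIneq_two_over hd hN) Λb B
  have hkN : 3 / kappa1 2 (n * L) = 3 * (((n * L : ℕ) : ℝ) + 1) / 2 := by rw [kappa1_two]; field_simp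
  rw [hkN] at hSB
  have hC := crossing_cover₂ hn hL hΛs hΛb hdisj B
  have hNB1 := sum_innerMinus_big_le hn hL hΛs hΛb hdisj hH hB0
  have hNB2 := sum_innerPlus_big_le hn hL hΛs hΛb hdisj hH hB0
  have hFB := faces_le_pCr hN hΛb B
  have hTB1 := sum_layerLast_big_le hd1 hn hL hΛs hΛb hdisj hH hB0 hTb
  have hTB2 := sum_layerFirst_big_le hd1 hn hL hΛs hΛb hdisj hH hB0 hTb
  have hIIB : (((n * L : ℕ) : ℝ)⁻¹) ^ d * nIn (n * L) Λb B ≤ (d : ℝ) * pIn (n * L) Λb B := ineq2123_rescaled hN Λb B hTb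
  -- the letters of the scalar assembly
  have hd1' := hd1
  have hNR : (1 : ℝ) ≤ ((n * L : ℕ) : ℝ) := by exact_mod_cast hN
  have hnR : (1 : ℝ) ≤ (n : ℝ) := by exact_mod_cast hn
  have hLR : (1 : ℝ) ≤ (L : ℝ) := by exact_mod_cast hL
  have hnN : (n : ℝ) ≤ ((n * L : ℕ) : ℝ) := by push_cast; nlinarith
  have hX0 : 0 ≤ ((n * L : ℕ) : ℝ)⁻¹ := inv_nonneg.2 (Nat.cast_nonneg _)
  have hX1 : ((n * L : ℕ) : ℝ)⁻¹ ≤ 1 := inv_le_one_of_one_le₀ hNR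
  have hXx : ((n * L : ℕ) : ℝ)⁻¹ ≤ (n : ℝ)⁻¹ := inv_anti₀ (by positivity) hnN
  have hp : 0 ≤ (((n * L : ℕ) : ℝ)⁻¹) ^ d := pow_nonneg hX0 _
  have hp₁ : 0 ≤ (((n * L : ℕ) : ℝ)⁻¹) ^ (d + 1) := pow_nonneg hX0 _
  have hp₁p : (((n * L : ℕ) : ℝ)⁻¹) ^ (d + 1) ≤ (((n * L : ℕ) : ℝ)⁻¹) ^ d := pow_le_pow_of_le_one hX0 hX1 (Nat.le_succ d)
  have hp₁q : (((n * L : ℕ) : ℝ)⁻¹) ^ (d + 1) ≤ ((n : ℝ)⁻¹) ^ (d + 1) := pow_le_pow_left₀ hX0 hXx _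
  have hqm : ((n : ℝ)⁻¹) ^ (d + 1) * (n : ℝ) ^ (d + 1) = 1 := by
    rw [← mul_pow, inv_mul_cancel₀ (by positivity), one_pow]
  have hm : 0 ≤ (n : ℝ) ^ (d + 1) := by positivity
  have hR : (1 : ℝ) ≤ ((n * L : ℕ) : ℝ) ^ (d - 2) := one_le_pow₀ hNR
  have hcr := coeff_cr_le hd1' hN
  have hτ := coeff_layer_le hd hN
  have hcN0 : 0 ≤ 3 * (((n * L : ℕ) : ℝ) + 1) / 2 * (((n * L : ℕ) : ℝ)⁻¹) ^ d := by positivity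
  have hgeom := composite_coeff_le hd1' hnR hnN
  have core := assembly_core_two (d : ℝ) (n : ℝ) ((n * L : ℕ) : ℝ) ((((n * L : ℕ) : ℝ)⁻¹) ^ d) ((((n * L : ℕ) : ℝ)⁻¹) ^ (d + 1))
    (((n : ℝ)⁻¹) ^ (d + 1)) ((n : ℝ) ^ (d + 1)) ((n : ℝ) ^ (d - 2)) (((n * L : ℕ) : ℝ) ^ (d - 2))
    (((d : ℝ) - 1) * (((n * L : ℕ) : ℝ) - 1) * ((n * L : ℕ) : ℝ) ^ (d - 2))
    (normSq₂ n L Λs Λb B) (nIn n Λs B) (nIn (n * L) Λb B) (pIn n Λs B) (pIn (n * L) Λb B)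
    (d1Sq n Λs B - pIn n Λs B) (d1Sq (n * L) Λb B - pIn (n * L) Λb B) (∑ c ∈ idxS n L Λs Λb, q1Term n B c) (q1Of (n * L) Λb B)
    (crossS n L Λs Λb B) (crossB n L Λb B) _ _ _ _ _ (by exact_mod_cast hd) hp hp₁ hp₁p hp₁q hqm hm (by positivity) hR hcr hτ hcN0 hgeom
    hNinS0 hNinB0 hPinS0 hPinB0 (hFS0.trans hFS) (hFB0.trans hFB) hQS0 (q1Of_nonneg Λb B) (crossS_nonneg Λs Λb B)
    hC hW hSB (by linarith [hNB1, hNB2]) hFB (by linarith [hTB1, hTB2]) hIIB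
  linarith [core]

/-- `κ₂`-packaging: **`κ₂·‖B‖² ≤ n^{d−2}Q^S + N^{d−2}Q^B + Σ_p^S + Σ_p^B`** with the explicit, volume-free `κ₂ = (12d²(1+12dn²))⁻¹·N^{−(d+1)}` (`N = nL`).
[cite: Balaban1984PropagatorsII, Lemma 2.4 (2.128) p.245, (2.89) p.239] -/
theorem lemma24_twoScale_kappa (hd : 2 ≤ d) (hn : 1 ≤ n) (hL : 1 ≤ L) {Λs Λb : Finset (Fin d → ℤ)}
    (hΛs : ∀ y ∈ Λs, ∀ i, (n : ℤ) ∣ y i) (hΛb : ∀ Y ∈ Λb, ∀ i, ((n * L : ℕ) : ℤ) ∣ Y i)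
    (hdisj : ∀ y ∈ Λs, corner (n * L) y ∉ Λb)
    (hH : ∀ Y ∈ Λb, ∀ μ : Fin d, Adm n L Λs Λb (Y + ((n * L : ℕ) : ℤ) • unitVec μ) ∧ Adm n L Λs Λb (Y - ((n * L : ℕ) : ℤ) • unitVec μ))
    (B : Cfg d) (hB0 : ∀ b, b ∉ bonds₂ n L Λs Λb → B b = 0)
    (hTs : ∀ y ∈ Λs, ∀ b ∈ treeBonds n y, B b = 0) (hTb : ∀ Y ∈ Λb, ∀ b ∈ treeBonds (n * L) Y, B b = 0) :
    (12 * (d : ℝ) ^ 2 * (1 + 12 * (d : ℝ) * (n : ℝ) ^ 2))⁻¹ * (((n * L : ℕ) : ℝ)⁻¹) ^ (d + 1) * normSq₂ n L Λs Λb B ≤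
      (n : ℝ) ^ (d - 2) * ∑ c ∈ idxS n L Λs Λb, q1Term n B c + ((n * L : ℕ) : ℝ) ^ (d - 2) * q1Of (n * L) Λb B +
        d1Sq n Λs B + d1Sq (n * L) Λb B := by
  have h := lemma24_twoScale hd hn hL hΛs hΛb hdisj hH B hB0 hTs hTb
  have hK : 0 < 12 * (d : ℝ) ^ 2 * (1 + 12 * (d : ℝ) * (n : ℝ) ^ 2) := by
    have : (2 : ℝ) ≤ d := by exact_mod_cast hd
    positivity
  rw [mul_assoc, inv_mul_le_iff₀ hK]
  exact h

/-! ## §3 (v1.1, append-only). ★★★ The two-scale letter WITHOUT the admissibility hypothesis -/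

/-- ★★★ **THE TWO-SCALE LEMMA-2.4 LETTER, ADMISSIBILITY-FREE.**  As `lemma24_twoScale` but with NO hypothesis on the `N`-neighbours of the big blocks: `d ≥ 2`, `n, L ≥ 1`,
`N = nL`, `Λs ⊂ nℤᵈ`, `Λb ⊂ Nℤᵈ` finite with disjoint regions, `B = 0` off `bonds₂`, tree gauge (2.121) in every small and every big block ⟹
`N^{−(d+1)}·‖B‖² ≤ 12d²·(1 + 12·d·n²)·( n^{d−2}·Σ_{c ∈ idxS} q1Term n B c + N^{d−2}·q1Of N Λb B + d1Sq n Λs B + d1Sq N Λb B )` — an `N`-position next to a big block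
and outside `Λb` is read as a GENERALISED composite (`B6Lemma24TwoScaleBookkeeping` §6: its sub-blocks outside `Λs` and internal faces not meeting `Λs` carry `B = 0`), so a
cube whose level-`j` part is NOT a union of `(j+1)`-positions is admitted. [cite: Balaban1984PropagatorsII, Lemma 2.4 (2.128) p.245, (2.89) p.239] -/
theorem lemma24_twoScale_noAdm (hd : 2 ≤ d) (hn : 1 ≤ n) (hL : 1 ≤ L) {Λs Λb : Finset (Fin d → ℤ)}
    (hΛs : ∀ y ∈ Λs, ∀ i, (n : ℤ) ∣ y i) (hΛb : ∀ Y ∈ Λb, ∀ i, ((n * L : ℕ) : ℤ) ∣ Y i)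
    (hdisj : ∀ y ∈ Λs, corner (n * L) y ∉ Λb)
    (B : Cfg d) (hB0 : ∀ b, b ∉ bonds₂ n L Λs Λb → B b = 0)
    (hTs : ∀ y ∈ Λs, ∀ b ∈ treeBonds n y, B b = 0) (hTb : ∀ Y ∈ Λb, ∀ b ∈ treeBonds (n * L) Y, B b = 0) :
    (((n * L : ℕ) : ℝ)⁻¹) ^ (d + 1) * normSq₂ n L Λs Λb B ≤
      12 * (d : ℝ) ^ 2 * (1 + 12 * (d : ℝ) * (n : ℝ) ^ 2) *
        ((n : ℝ) ^ (d - 2) * ∑ c ∈ idxS n L Λs Λb, q1Term n B c + ((n * L : ℕ) : ℝ) ^ (d - 2) * q1Of (n * L) Λb B +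
          d1Sq n Λs B + d1Sq (n * L) Λb B) := by
  have hN : 1 ≤ n * L := Nat.mul_pos hn hL
  have hd1 : 1 ≤ d := le_trans (by norm_num) hd
  -- the small scale: pv09's assembly with `Nrm := crossS + N_in^S`
  have hκn : 0 < kappa1 2 n := kappa1_pos (by norm_num) hn
  have hSS := sum_face_split_idxS (L := L) hd hn hκn (layerIneq_two_over hd hn) Λs Λb B
  have hkn : 3 / kappa1 2 n = 3 * ((n : ℝ) + 1) / 2 := by rw [kappa1_two]; field_simp
  rw [hkn] at hSS
  have hNS1 := sum_blockSq_idxS_minus_le hn hL hΛs hΛb hB0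
  have hNS2 := sum_blockSq_idxS_plus_le hn hL hΛs hΛb hB0
  have hFS := faces_idxS_le (L := L) hn hΛs Λb B
  have hTS1 := sum_layerLast_idxS_le hd1 hn hL hΛs hΛb hB0 hTs
  have hTS2 := sum_layerFirst_idxS_le hd1 hn hL hΛs hΛb hB0 hTs
  have hIIS : ((n : ℝ)⁻¹) ^ d * nIn n Λs B ≤ (d : ℝ) * pIn n Λs B := ineq2123_rescaled hn Λs B hTs
  have hNinS0 : 0 ≤ nIn n Λs B := sum_nonneg fun _ _ => sum_nonneg fun _ _ => sq_nonneg _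
  have hNinB0 : 0 ≤ nIn (n * L) Λb B := sum_nonneg fun _ _ => sum_nonneg fun _ _ => sq_nonneg _
  have hPinS0 : 0 ≤ pIn n Λs B := sum_nonneg fun _ _ => sum_nonneg fun _ _ => sq_nonneg _
  have hPinB0 : 0 ≤ pIn (n * L) Λb B := sum_nonneg fun _ _ => sum_nonneg fun _ _ => sq_nonneg _
  have hFS0 : (0 : ℝ) ≤ ∑ c ∈ idxS n L Λs Λb, ∑ b ∈ bondsIn (lastLayer n c.1 c.2), curl B b.1 b.2 c.2 ^ 2 :=
    sum_nonneg fun _ _ => sum_nonneg fun _ _ => sq_nonneg _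
  have hFB0 : (0 : ℝ) ≤ ∑ C ∈ coarseBonds (n * L) Λb, ∑ b ∈ bondsIn (lastLayer (n * L) C.1 C.2), curl B b.1 b.2 C.2 ^ 2 :=
    sum_nonneg fun _ _ => sum_nonneg fun _ _ => sq_nonneg _
  have hQS0 : (0 : ℝ) ≤ ∑ c ∈ idxS n L Λs Λb, q1Term n B c := sum_nonneg fun _ _ => sq_nonneg _
  have hW := assembly_core_one d n hd hn (crossS n L Λs Λb B + nIn n Λs B) (nIn n Λs B) (pIn n Λs B) (d1Sq n Λs B - pIn n Λs B)
    (∑ c ∈ idxS n L Λs Λb, q1Term n B c) (crossS n L Λs Λb B) _ _ _ _ _ hNinS0 hPinS0 (hFS0.trans hFS) hQS0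
    (by linarith) hSS hNS1 hNS2 hFS hTS1 hTS2 hIIS
  -- the big scale, admissibility-free absorptions
  have hκN : 0 < kappa1 2 (n * L) := kappa1_pos (by norm_num) hN
  have hSB := sum_face_split hd hN hκN (layerIneq_two_over hd hN) Λb B
  have hkN : 3 / kappa1 2 (n * L) = 3 * (((n * L : ℕ) : ℝ) + 1) / 2 := by rw [kappa1_two]; field_simp
  rw [hkN] at hSB
  have hC := crossing_cover₂ hn hL hΛs hΛb hdisj B
  have hNB1 := B6Lemma24TwoScaleBookkeeping.sum_innerMinus_big_le_noAdm hn hL hΛs hΛb hB0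
  have hNB2 := B6Lemma24TwoScaleBookkeeping.sum_innerPlus_big_le_noAdm hn hL hΛs hΛb hB0
  have hFB := faces_le_pCr hN hΛb B
  have hTB1 := B6Lemma24TwoScaleBookkeeping.sum_layerLast_big_le_noAdm hd1 hn hL hΛs hΛb hB0 hTb
  have hTB2 := B6Lemma24TwoScaleBookkeeping.sum_layerFirst_big_le_noAdm hd1 hn hL hΛs hΛb hB0 hTb
  have hIIB : (((n * L : ℕ) : ℝ)⁻¹) ^ d * nIn (n * L) Λb B ≤ (d : ℝ) * pIn (n * L) Λb B := ineq2123_rescaled hN Λb B hTb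
  -- the letters of the scalar assembly
  have hNR : (1 : ℝ) ≤ ((n * L : ℕ) : ℝ) := by exact_mod_cast hN
  have hnR : (1 : ℝ) ≤ (n : ℝ) := by exact_mod_cast hn
  have hLR : (1 : ℝ) ≤ (L : ℝ) := by exact_mod_cast hL
  have hnN : (n : ℝ) ≤ ((n * L : ℕ) : ℝ) := by push_cast; nlinarith
  have hX0 : 0 ≤ ((n * L : ℕ) : ℝ)⁻¹ := inv_nonneg.2 (Nat.cast_nonneg _)
  have hX1 : ((n * L : ℕ) : ℝ)⁻¹ ≤ 1 := inv_le_one_of_one_le₀ hNR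
  have hXx : ((n * L : ℕ) : ℝ)⁻¹ ≤ (n : ℝ)⁻¹ := inv_anti₀ (by positivity) hnN
  have hp : 0 ≤ (((n * L : ℕ) : ℝ)⁻¹) ^ d := pow_nonneg hX0 _
  have hp₁ : 0 ≤ (((n * L : ℕ) : ℝ)⁻¹) ^ (d + 1) := pow_nonneg hX0 _
  have hp₁p : (((n * L : ℕ) : ℝ)⁻¹) ^ (d + 1) ≤ (((n * L : ℕ) : ℝ)⁻¹) ^ d := pow_le_pow_of_le_one hX0 hX1 (Nat.le_succ d)
  have hp₁q : (((n * L : ℕ) : ℝ)⁻¹) ^ (d + 1) ≤ ((n : ℝ)⁻¹) ^ (d + 1) := pow_le_pow_left₀ hX0 hXx _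
  have hqm : ((n : ℝ)⁻¹) ^ (d + 1) * (n : ℝ) ^ (d + 1) = 1 := by
    rw [← mul_pow, inv_mul_cancel₀ (by positivity), one_pow]
  have hm : 0 ≤ (n : ℝ) ^ (d + 1) := by positivity
  have hR : (1 : ℝ) ≤ ((n * L : ℕ) : ℝ) ^ (d - 2) := one_le_pow₀ hNR
  have hcr := coeff_cr_le hd1 hN
  have hτ := coeff_layer_le hd hN
  have hcN0 : 0 ≤ 3 * (((n * L : ℕ) : ℝ) + 1) / 2 * (((n * L : ℕ) : ℝ)⁻¹) ^ d := by positivity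
  have hgeom := composite_coeff_le hd1 hnR hnN
  have core := assembly_core_two (d : ℝ) (n : ℝ) ((n * L : ℕ) : ℝ) ((((n * L : ℕ) : ℝ)⁻¹) ^ d) ((((n * L : ℕ) : ℝ)⁻¹) ^ (d + 1))
    (((n : ℝ)⁻¹) ^ (d + 1)) ((n : ℝ) ^ (d + 1)) ((n : ℝ) ^ (d - 2)) (((n * L : ℕ) : ℝ) ^ (d - 2))
    (((d : ℝ) - 1) * (((n * L : ℕ) : ℝ) - 1) * ((n * L : ℕ) : ℝ) ^ (d - 2))
    (normSq₂ n L Λs Λb B) (nIn n Λs B) (nIn (n * L) Λb B) (pIn n Λs B) (pIn (n * L) Λb B)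
    (d1Sq n Λs B - pIn n Λs B) (d1Sq (n * L) Λb B - pIn (n * L) Λb B) (∑ c ∈ idxS n L Λs Λb, q1Term n B c) (q1Of (n * L) Λb B)
    (crossS n L Λs Λb B) (crossB n L Λb B) _ _ _ _ _ (by exact_mod_cast hd) hp hp₁ hp₁p hp₁q hqm hm (by positivity) hR hcr hτ hcN0 hgeom
    hNinS0 hNinB0 hPinS0 hPinB0 (hFS0.trans hFS) (hFB0.trans hFB) hQS0 (q1Of_nonneg Λb B) (crossS_nonneg Λs Λb B)
    hC hW hSB (by linarith [hNB1, hNB2]) hFB (by linarith [hTB1, hTB2]) hIIB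
  linarith [core]

/-- `κ₂`-packaging, admissibility-free: **`κ₂·‖B‖² ≤ n^{d−2}Q^S + N^{d−2}Q^B + Σ_p^S + Σ_p^B`**, `κ₂ = (12d²(1+12dn²))⁻¹·N^{−(d+1)}`.
[cite: Balaban1984PropagatorsII, Lemma 2.4 (2.128) p.245, (2.89) p.239] -/
theorem lemma24_twoScale_kappa_noAdm (hd : 2 ≤ d) (hn : 1 ≤ n) (hL : 1 ≤ L) {Λs Λb : Finset (Fin d → ℤ)}
    (hΛs : ∀ y ∈ Λs, ∀ i, (n : ℤ) ∣ y i) (hΛb : ∀ Y ∈ Λb, ∀ i, ((n * L : ℕ) : ℤ) ∣ Y i)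
    (hdisj : ∀ y ∈ Λs, corner (n * L) y ∉ Λb)
    (B : Cfg d) (hB0 : ∀ b, b ∉ bonds₂ n L Λs Λb → B b = 0)
    (hTs : ∀ y ∈ Λs, ∀ b ∈ treeBonds n y, B b = 0) (hTb : ∀ Y ∈ Λb, ∀ b ∈ treeBonds (n * L) Y, B b = 0) :
    (12 * (d : ℝ) ^ 2 * (1 + 12 * (d : ℝ) * (n : ℝ) ^ 2))⁻¹ * (((n * L : ℕ) : ℝ)⁻¹) ^ (d + 1) * normSq₂ n L Λs Λb B ≤
      (n : ℝ) ^ (d - 2) * ∑ c ∈ idxS n L Λs Λb, q1Term n B c + ((n * L : ℕ) : ℝ) ^ (d - 2) * q1Of (n * L) Λb B +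
        d1Sq n Λs B + d1Sq (n * L) Λb B := by
  have h := lemma24_twoScale_noAdm hd hn hL hΛs hΛb hdisj B hB0 hTs hTb
  have hK : 0 < 12 * (d : ℝ) ^ 2 * (1 + 12 * (d : ℝ) * (n : ℝ) ^ 2) := by
    have : (2 : ℝ) ≤ d := by exact_mod_cast hd
    positivity
  rw [mul_assoc, inv_mul_le_iff₀ hK]
  exact h

end

end Literature.MathematicalPhysics.QuantumFieldTheory.Balaban1983to89.B6Lemma24TwoScale
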